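import Summits.BirchSwinnertonDyer.Rank1Residual.Partition.MainConjecturesCoveredAllPrimes
import Summits.BirchSwinnertonDyer.Rank1Residual.Partition.MainConjecturesEisensteinBDP
import Literature.NumberTheory.EllipticCurves.Greenberg1999.RankZeroEulerCharacteristicOddPrimeProofs
import HarnessLib

/-!
# The COVERED part of the partition at EVERY prime with every Eisenstein-row input a NUMBERED
# published theorem and Greenberg's Thm. 4.1 DERIVED (cell `b2b-bsdres`; off-peak typer `lit-cgls`,
# session 7 — the closing corollary of the lineage's S1b programme; a leaf over the GLUE seat's
# capstone `MainConjecturesCoveredAllPrimes.lean`, which is NOT modified)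

HONEST FRAMING (cell `b2b-bsdres`, run/shared/lean/b2b/bsd-rank1-residual/, verbatim in every
file): the goal of the cell is to DELETE the COMBINATION-SHAPED residual classes of the
Birch–Swinnerton-Dyer formula for ALL analytic-rank `≤ 1` elliptic curves over `ℚ` — "full BSD
formula for every rank `≤ 1` curve in class `C`" assembled STRICTLY from published theorems — so
that the rank-`≤ 1` remainder becomes exactly the CONSTRUCTION-SHAPED classes, which are TYPED
(missing-input `Prop`s), NOT attempted. This is not "finishing BSD". Research routes; no claim
beyond the stated classes; nothing booked; no label changes. THEOREMS ONLY (no definition, no named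
fact, no `sorry`); every published theorem enters as one of the tree's existing named Literature
facts BY NAME; every unproved / untyped-in-Literature statement enters as an EXPLICIT binder.

## What this file records

`bsdp_of_covered_of_mainConjectures_allPrimes_numbered` — the GLUE seat's capstone
`bsdp_of_covered_of_mainConjectures_allPrimes` (gen 5: for `E/ℚ` globally minimal of analytic rank
`≤ 1` and ANY prime `p`, `Covered W p ⇒ BSD(E,p)` at main-conjecture level) with TWO binders replaced
by their antecedents / derivations now in the tree:

* the binder `h55 : display55_sha_heegnerIndex` (registry A157 = Castella–Grossi–Lee–Skinner 2022
  display (5.5), an UNNUMBERED display inside the printed proof of Thm. 5.3.1) is REPLACED by the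
  two NUMBERED theorems it is printed from — `h54 : display54_thm513_generator_constantCoeff`
  (A173 = CGLS Thm. 4.2.2 at the trivial character ∘ Thm. 5.1.3, on the Literature object `𝔛_E`)
  and `h511 : thm511_anticyclotomicControl` (A170 = CGLS Thm. 5.1.1) — through the kernel
  derivation `display55_of_display54_of_thm511` (`MainConjecturesEisensteinBDP.lean`, lit-cgls
  session 6; the anticyclotomic datum is PRODUCED there, the anomaly factor and the logarithm cancel);
* the binder `hGr : greenberg_charValue_rankZero` (Greenberg LNM 1716 Thm. 4.1) is DERIVED from
  the binders `hSo` (Perrin-Riou–Schneider = Balakrishnan–Müller–Stein 2016 Thm. 1.7, odd `p`) and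
  `hMT` (Mazur–Stein–Tate 2006 Thm. 1.3, odd `p`) that the capstone already carries, by lit-su's
  `greenberg_charValue_rankZero_of_Schneider1985_odd`
  (`Greenberg1999/RankZeroEulerCharacteristicOddPrimeProofs.lean`, p247807).

Net effect on the statement of record for the COVERED half of the partition: row C6 (good
non-anomalous Eisenstein `p > 2`, `r ≤ 1`) and row C7 now rest on MAIN-CONJECTURE-level NUMBERED
published theorems only — Castella–Grossi–Skinner 2025 Thm. A (`hCGSA`, cyclotomic), CGLS 2022
Thm. 4.2.2 ∘ 5.1.3 (`h54`, anticyclotomic at `𝟙`), CGLS 2022 Thm. 5.1.1 (`h511`, control),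
Greenberg–Vatsal 2000 Thm. (1.3) (`hGV`) — plus the generic published facts the capstone lists; the
binder count drops by one (`−h55 −hGr +h54 +h511`). All other rows, the typed links `hLC`/`hLA`,
`hKMC`, `hSch3`, `htam` and the two CM final statements are EXACTLY as in the capstone (see its
module docstring for the row-by-row dispatch). Nothing about any particular curve is asserted.

References: `Partition/MainConjecturesCoveredAllPrimes.lean` (lit-glue gen 5);
`Partition/MainConjecturesEisensteinBDP.lean` (lit-cgls session 6);
`Literature/…/CastellaGrossiLeeSkinner2022/{BDPValueAtTrivialCharacter,AnticyclotomicControl}.lean`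
(A173, A170); HOME/b2b-bsdres-lit-cgls/CGLS-GV-TYPING.md §13–§14; RESIDUAL-CASES.md §a.1;
HOME/PARTITION.md.
-/

set_option autoImplicit false

noncomputable section

open scoped Classical MatrixGroups ModularForm

open CongruenceSubgroup WeierstrassCurve NumberField IsDedekindDomain
  Literature.NumberTheory.EllipticCurves Literature.NumberTheory.Automorphic
  Literature.NumberTheory.EllipticCurves.ModularForms
  Literature.NumberTheory.EllipticCurves.Rank1Residual
  Literature.NumberTheory.EllipticCurves.Rank1Residual.Typed
  Literature.NumberTheory.EllipticCurves.CastellaGrossiLeeSkinner2022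
  Literature.NumberTheory.EllipticCurves.BurungaleCastellaSkinner2025
  Literature.NumberTheory.EllipticCurves.YanZhu2026
  Literature.NumberTheory.EllipticCurves.Skinner2016
  Literature.NumberTheory.EllipticCurves.SteinWuthrich2013
  Literature.NumberTheory.EllipticCurves.Kobayashi2003
  Literature.NumberTheory.EllipticCurves.BurungaleKobayashiOta2024
  Literature.NumberTheory.EllipticCurves.PollackRubin2004 ZpExtension
  Summit.BirchSwinnertonDyer.BirchSwinnertonDyer.Theorems.Rank1ResidualX1Defs

namespace Summit.BirchSwinnertonDyer.Rank1Residual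

/-- **The covered part of the partition at EVERY prime, every Eisenstein-row input a NUMBERED
published theorem, Greenberg Thm. 4.1 derived.** For `E/ℚ` (globally minimal `W`) with `r_an ≤ 1`
and any prime `p`: `Covered W p ⇒ BSD(E,p)`, granted exactly the binders of the GLUE capstone
`bsdp_of_covered_of_mainConjectures_allPrimes` EXCEPT that `h55` (CGLS display (5.5), A157) is
replaced by `h54` (CGLS Thm. 4.2.2 ∘ 5.1.3 at `𝟙` on `𝔛_E`, A173) and `h511` (CGLS Thm. 5.1.1,
A170), and `hGr` (Greenberg Thm. 4.1) is no longer asked (derived from `hSo`, `hMT`). Proof: the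
capstone, fed by `display55_of_display54_of_thm511` and
`greenberg_charValue_rankZero_of_Schneider1985_odd`.
[cite: CastellaGrossiLeeSkinner2022, Thm. 4.2.2, Thm. 5.1.1, Thm. 5.1.3, display (5.4)]
[cite: CastellaGrossiSkinner2025, Theorem A] [cite: GreenbergVatsal2000, Thm. (1.3)]
[cite: BalakrishnanMullerStein2015, Thm. 1.7] [cite: Miller2011LMS, Def. 1.1] -/
theorem bsdp_of_covered_of_mainConjectures_allPrimes_numbered
    -- main conjectures: PUBLISHED named facts
    (hSU : ∀ (W : WeierstrassCurve ℚ) [W.IsElliptic] [W.IsGloballyMinimal] (p : ℕ) [Fact p.Prime]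
      (κ : ZpExtension ℚ p) (γ : Field.absoluteGaloisGroup ℚ) (N : ℕ) [NeZero N]
      (f : CuspForm (Gamma0 N) 2),
      skinner_urban_main_conjecture W p (κ := κ) (γ := γ) (f := f))
    (hA : thmA_charIdeal_multiplicative)
    (hBCS : thm112b_charIdeal_eq_padicLFunction_integral)
    (hYZ : thm49_charIdeal_eq_padicLFunction_integral)
    (hCGSA : CastellaGrossiSkinner2025.thmA_charIdeal_eq_padicLFunction)
    (h54 : display54_thm513_generator_constantCoeff) (h511 : thm511_anticyclotomicControl)
    (hGV : GreenbergVatsal2000.thm13_charIdeal_eq_of_gvPar)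
    (hRu : Rubin1991.thm123_charIdeal_eq_padicLFunction_of_cm)
    (hPR : PollackRubin2004.mainTheorem_signedCharIdeal_eq_of_cm)
    -- control / leading-term / link theorems: named facts
    (hJs : thm61_splitMultiplicative) (hJn : thm61_nonsplitMultiplicative)
    (hGS : ∀ (W : WeierstrassCurve ℚ) [W.IsElliptic] [W.IsGloballyMinimal] (p : ℕ) [Fact p.Prime],
      greenberg_stevens (W := W) (p := p))
    (h5 : realPeriodRat_eq_unit_mul_plusPeriod) (h3 : realPeriodRat_eq_unit_mul_plusPeriod_three)
    (hS : Schneider1985_order_charGenerator) (hPRio : perrinRiou_rankOne_leadingTerms)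
    (hSo : Schneider1985_order_charGenerator_odd) (hPRo : perrinRiou_rankOne_leadingTerms_odd)
    (hMT : mazur_tate_sigma_exists_odd) (hBer : bertrand_pairing_self_ne_zero_of_hasCM)
    (h12 : Kobayashi2003.thm12_signedSelmerDual_finite_torsion)
    (hKim : BDKim2013.cor315_signedCharValue_rankZero)
    (hA5 : corA5_pPart_of_signedCharIdeal_eq)
    (hW20 : Wuthrich2014.lemma20_surjective_threeAdic_of_semistable)
    (hGZQ : GrossZagier1986_thm_I_7_3)
    (hGZ : ∀ (N : ℕ) [NeZero N] (W : WeierstrassCurve ℚ) (K : Type) [Field K] [NumberField K],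
      gross_zagier N W K)
    (hKo : ∀ (N : ℕ) [NeZero N] (W : WeierstrassCurve ℚ) (K : Type) [Field K] [NumberField K],
      kolyvagin N W K)
    (hB : ∀ (N : ℕ) [NeZero N] (W : WeierstrassCurve ℚ) (K : Type) [Field K] [NumberField K],
      Kolyvagin1990_padicValNat_card_sha_le N W K)
    (hHL : HoffsteinLuo1997_exists_twist_L_one_ne_zero)
    (hMaz : mazur_not_dvd_maninConstant_of_odd) (hNS : integral_neronScaling_of_isGloballyMinimal)
    (hCassels : bsdRHS_eq_of_isIsogenous) (hLL : diamond1995_refinedSerre)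
    -- the two final statements (CM rows off the good odd locus)
    (hCM : bsdTriple_of_hasCM_of_L_one_ne_zero) (hLLT : LiLiuTian2024.thm11_bsdp_of_cm_rank_one)
    -- modularity, GZK
    (hmod : hasEntireLFunction_rat) (hmodP : nonempty_modularParametrizationData)
    (hnf : exists_isNewformOf) (hGZK : rank_eq_analyticRank_of_analyticRank_le_one)
    -- the anticyclotomic links AS TYPED on the constructed `X_ac`
    (hLC : ∀ (W : WeierstrassCurve ℚ) [W.IsElliptic] [W.IsGloballyMinimal] (p : ℕ) [Fact p.Prime]
      (N : ℕ) [NeZero N] (K : Type) [Field K] [NumberField K]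
      (Dt : ModularParametrizationData W N) (H : HeegnerDatum N (NumberField.discr K)) (ι : K →+* ℂ)
      (P : (W.baseChange K).toAffine.Point),
      GoodOrd W p → Irr W p → Surj W p → W.analyticRank = 1 → ¬ p ∣ W.tamagawaProduct →
      W.conductorNorm ℤ = N → IsImaginaryQuadratic K → Odd (NumberField.discr K) →
      NumberField.discr K < -4 → SatisfiesHeegnerHypothesis N K → SatisfiesHeegnerHypothesis p K →
      (W.quadraticTwist (NumberField.discr K : ℚ)).entireLFunction 1 ≠ 0 →
      WeierstrassCurve.Affine.Point.map ι.toRatAlgHom P = heegnerPointComplex Dt H →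
      ¬ (p : ℤ) ∣ Dt.c → ¬ IsOfFinAddOrder P →
      ∀ (κ : ZpExtension K p), κ.IsAnticyclotomic →
        ∀ (γ : Field.absoluteGaloisGroup K) [Fact (κ.IsTopGenerator γ)]
          (𝔭 : HeightOneSpectrum (𝓞 K)) (h𝔭 : ((p : ℕ) : 𝓞 K) ∈ 𝔭.asIdeal)
          (he : 𝔭.asIdeal.ramificationIdx (𝓞 ℚ) = 1) (hf : 𝔭.asIdeal.inertiaDeg (𝓞 ℚ) = 1),
          X11b.ControlOnTreeGoodAt p κ 𝔭 γ (X11b.embAt K p 𝔭 h𝔭 he hf) P)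
    (hLA : ∀ (W : WeierstrassCurve ℚ) [W.IsElliptic] [W.IsGloballyMinimal] (p : ℕ) [Fact p.Prime]
      (N : ℕ) [NeZero N] (K : Type) [Field K] [NumberField K]
      (Dt : ModularParametrizationData W N) (H : HeegnerDatum N (NumberField.discr K)) (ι : K →+* ℂ)
      (P : (W.baseChange K).toAffine.Point),
      GoodOrd W p → Irr W p → Surj W p → W.analyticRank = 1 → ¬ p ∣ W.tamagawaProduct →
      W.conductorNorm ℤ = N → IsImaginaryQuadratic K → Odd (NumberField.discr K) →
      NumberField.discr K < -4 → SatisfiesHeegnerHypothesis N K → SatisfiesHeegnerHypothesis p K →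
      (W.quadraticTwist (NumberField.discr K : ℚ)).entireLFunction 1 ≠ 0 →
      WeierstrassCurve.Affine.Point.map ι.toRatAlgHom P = heegnerPointComplex Dt H →
      ¬ (p : ℤ) ∣ Dt.c → ¬ IsOfFinAddOrder P →
      ∀ (κ : ZpExtension K p), κ.IsAnticyclotomic →
        ∀ (γ : Field.absoluteGaloisGroup K) [Fact (κ.IsTopGenerator γ)]
          (𝔭 : HeightOneSpectrum (𝓞 K)) (h𝔭 : ((p : ℕ) : 𝓞 K) ∈ 𝔭.asIdeal)
          (he : 𝔭.asIdeal.ramificationIdx (𝓞 ℚ) = 1) (hf : 𝔭.asIdeal.inertiaDeg (𝓞 ℚ) = 1),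
          X11b.IMCLowerWaldspurgerOnTreeGoodAt p κ 𝔭 γ (X11b.embAt K p 𝔭 h𝔭 he hf) P)
    -- the pair
    (W : WeierstrassCurve ℚ) [W.IsElliptic] [W.IsGloballyMinimal] (p : ℕ) [Fact p.Prime]
    (hr : W.analyticRank ≤ 1)
    (hPollack : ∀ {N : ℕ} [NeZero N] {f : CuspForm (Gamma0 N) 2},
      pollack_exists_plusMinusPAdicLFunction (W := W) (f := f) (p := p))
    (ε : ℤˣ)
    (hKMC : RowC3 W p → (p : ℤ) ∣ W.frobeniusTrace p → Supersingular.KobayashiMainConjecture W p ε)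
    (hSch3 : W.HasCM → W.analyticRank = 1 → CMSplit W 3 →
      ∀ Dh : PAdicHeightData W 3, Dh.IsCanonical → SchneiderConjecture Dh)
    (htam : W.analyticRank = 1 → Irr W p → Surj W p → ¬ p ∣ W.tamagawaProduct)
    (h : Covered W p) : BSDp W p :=
  bsdp_of_covered_of_mainConjectures_allPrimes hSU hA hBCS hYZ hCGSA
    (display55_of_display54_of_thm511 h54 h511 hnf hGZ hGZK) hGV hRu hPR
    (greenberg_charValue_rankZero_of_Schneider1985_odd hSo hMT) hJs hJn hGS h5 h3 hS hPRio hSo hPRo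
    hMT hBer h12 hKim hA5 hW20 hGZQ hGZ hKo hB hHL hMaz hNS hCassels hLL hCM hLLT hmod hmodP hnf hGZK
    hLC hLA W p hr hPollack ε hKMC hSch3 htam h

end Summit.BirchSwinnertonDyer.Rank1Residual

end
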